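import Summits.QuantumAdvantage.QuantumAdvantage.Theorems.CharDialTokenDialD1
import HarnessLib

/-!
# CharDial tower — the TOKEN DIAL, part D2: the local engine's data (rich set, mirrored cells, reader decisions, flip table; §8a)

Cell `decomp-qadv`, lens 6, generation 19 (REV1); supports stmt-QuantumAdvantage-27206 / 27207 (crux 32604).  Imports part D1.

* `richLoc y s t` — the RICH SET of the pair (strategy-level, presentation-free): inputs with `u_s ≠ u_t`, every cut other than
  cut `t` inert under the transposition, cut `t` accepting before or after.
* `formsOf`, `swapT`, `corr`, `decB`, `decA`, `idxM`, `card_idxM_le`, `swap_mem_cellM`, `strat_before`, `strat_after`: on a multi-form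
  cell fixing the junta bits on `O ⊇ {s,t} ∪ ⋃_{g ∈ G'} J_g` and the form values of the cuts in `G'`, every reader's decision BEFORE
  and AFTER the swap is a constant read off the cell index (the transposed input lies in the mirrored cell `swapT`, form values
  shifted by `corr = ±(a_g(t) − a_g(s))`); `richLoc_subset`: the rich set is a union of at most `2^{|O|}·p^{|G'|}` ACTIVE cells.
* `res1`, `res2`, `flip_key`, `flipCellM`, `flipCellM_subset`, `cellM_disjoint`: in each acceptance case (before only / after only /
  both) exactly TWO of the three address classes of cut `t` flip the win bit (a 36-case finite check), and they lie in `flipE`.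
0 sorry.  Part D (module `CharDialTokenDialD`) sums this into the local engine inequality.
-/

set_option autoImplicit false

namespace Summit.QuantumAdvantage.AdviceFreeQNC0.JLinPeel.TokenDial

open Finset SegMove

variable {n : ℕ}

/-! ### §8 the local engine -/

section LocEngine

variable {p : ℕ} [hp : Fact p.Prime]

/-- **the rich set** of the pair `(s, t)` for a strategy `y`: swap-set inputs at which every cut other than cut `t` is INERT
under the transposition and cut `t` accepts the input or its transpose. -/
def richLoc (y : Fin (n + 1) → (Fin n → Bool) → Bool) (s t : Fin n) : Finset (Fin n → Bool) :=
  univ.filter fun u => u s ≠ u t ∧ (∀ g : Fin (n + 1), g ≠ cut t → y g (segCompl u s.val (s.val + 2)) = y g u) ∧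
    (y (cut t) u = true ∨ y (cut t) (segCompl u s.val (s.val + 2)) = true)

omit hp in
/-- membership in `richLoc`. -/
theorem mem_richLoc (y : Fin (n + 1) → (Fin n → Bool) → Bool) (s t : Fin n) (u : Fin n → Bool) :
    u ∈ richLoc y s t ↔ u s ≠ u t ∧ (∀ g : Fin (n + 1), g ≠ cut t → y g (segCompl u s.val (s.val + 2)) = y g u) ∧
      (y (cut t) u = true ∨ y (cut t) (segCompl u s.val (s.val + 2)) = true) := by
  unfold richLoc; rw [mem_filter]; simp only [mem_univ, true_and]

/-- the forms of the presentation on a set of cuts `G'` (zero elsewhere). -/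
def formsOf (D : JLinData p n) (G' : Finset (Fin (n + 1))) : Fin (n + 1) → Fin n → ZMod p := fun g =>
  if g ∈ G' then D.a g else 0

/-- the pattern set of the transposed input: toggle `s` and `t`. -/
def swapT (T : Finset (Fin n)) (s t : Fin n) : Finset (Fin n) := (T \ {s, t}) ∪ ({s, t} \ T)

/-- the form shifts under the transposition (on `G'`). -/
def corr (D : JLinData p n) (G' : Finset (Fin (n + 1))) (s t : Fin n) (T : Finset (Fin n)) : Fin (n + 1) → ZMod p :=
  fun g => if g ∈ G' then (if s ∈ T then D.a g t - D.a g s else D.a g s - D.a g t) else 0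

/-- the decision of cut `g` BEFORE the swap, read off a cell index. -/
def decB (D : JLinData p n) (T : Finset (Fin n)) (V : Fin (n + 1) → ZMod p) (g : Fin (n + 1)) : Bool :=
  D.h g (patt T) (V g)

/-- the decision of cut `g` AFTER the swap, read off a cell index. -/
def decA (D : JLinData p n) (G' : Finset (Fin (n + 1))) (s t : Fin n) (T : Finset (Fin n)) (V : Fin (n + 1) → ZMod p)
    (g : Fin (n + 1)) : Bool :=
  D.h g (patt (swapT T s t)) (V g + corr D G' s t T g)

omit hp in
/-- the toggled pattern at `s`. -/
theorem patt_swapT_s (T : Finset (Fin n)) (s t : Fin n) : patt (swapT T s t) s = !patt T s := by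
  unfold patt swapT
  by_cases hs : s ∈ T <;> simp [hs]

omit hp in
/-- the toggled pattern at `t`. -/
theorem patt_swapT_t (T : Finset (Fin n)) (s t : Fin n) : patt (swapT T s t) t = !patt T t := by
  unfold patt swapT
  by_cases ht : t ∈ T <;> simp [ht]

omit hp in
/-- the toggled pattern elsewhere. -/
theorem patt_swapT_of_ne (T : Finset (Fin n)) (s t j : Fin n) (hjs : j ≠ s) (hjt : j ≠ t) :
    patt (swapT T s t) j = patt T j := by
  unfold patt swapT
  by_cases hj : j ∈ T <;> simp [hj, hjs, hjt]

omit hp in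
/-- the transposed input carries the toggled pattern. -/
theorem swap_patt (u : Fin n → Bool) (O : Finset (Fin n)) (T : Finset (Fin n)) (s t : Fin n) (hst : t.val = s.val + 1)
    (hpat : ∀ j ∈ O, u j = patt T j) (hsO : s ∈ O) (htO : t ∈ O) :
    ∀ j ∈ O, segCompl u s.val (s.val + 2) j = patt (swapT T s t) j := by
  intro j hj
  by_cases hjs : j = s
  · rw [hjs, swap_apply_s, hpat s hsO, patt_swapT_s]
  · by_cases hjt : j = t
    · rw [hjt, swap_apply_t u s t hst, hpat t htO, patt_swapT_t]
    · rw [swap_apply_of_ne u s t hst j hjs hjt, hpat j hj, patt_swapT_of_ne T s t j hjs hjt]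

/-- the zero form. -/
theorem form_zero (w : Fin n → Bool) : form (0 : Fin n → ZMod p) w = 0 := by
  unfold form
  exact Finset.sum_eq_zero fun i _ => by split_ifs <;> rfl

omit hp in
/-- a pattern bit as a membership. -/
theorem patt_eq_true (T : Finset (Fin n)) (j : Fin n) : patt T j = true ↔ j ∈ T := by
  unfold patt; simp

/-- **the transposed input lies in the mirrored cell**, with form values shifted by `corr`. -/
theorem swap_mem_cellM (D : JLinData p n) (G' : Finset (Fin (n + 1))) (O : Finset (Fin n)) (s t : Fin n)
    (hst : t.val = s.val + 1) (hsO : s ∈ O) (htO : t ∈ O) (T : Finset (Fin n)) (V : Fin (n + 1) → ZMod p)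
    (u : Fin n → Bool) (hu : u ∈ cellM O (patt T) (formsOf D G') V) (hne : u s ≠ u t) :
    segCompl u s.val (s.val + 2) ∈ cellM O (patt (swapT T s t)) (formsOf D G') (fun g => V g + corr D G' s t T g) := by
  rw [mem_cellM] at hu ⊢
  obtain ⟨hpat, hform⟩ := hu
  refine ⟨swap_patt u O T s t hst hpat hsO htO, fun g => ?_⟩
  have hus : u s = true ↔ s ∈ T := by rw [hpat s hsO, patt_eq_true]
  have hg := hform g
  unfold formsOf at hg
  unfold formsOf corr
  by_cases hG : g ∈ G'
  · simp only [if_pos hG] at hg ⊢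
    rw [form_swap (D.a g) u s t hst hne, hg]
    by_cases hs : s ∈ T
    · rw [if_pos (hus.2 hs), if_pos hs]
    · have : ¬ u s = true := fun h => hs (hus.1 h)
      rw [if_neg this, if_neg hs]
  · simp only [if_neg hG] at hg ⊢
    rw [form_zero, add_zero, ← hg, form_zero]

/-- a reader's decision BEFORE the swap is the index's `decB` on the cell. -/
theorem strat_before (D : JLinData p n) (G' : Finset (Fin (n + 1))) (O : Finset (Fin n)) (T : Finset (Fin n))
    (V : Fin (n + 1) → ZMod p) (u : Fin n → Bool) (hu : u ∈ cellM O (patt T) (formsOf D G') V) (g : Fin (n + 1))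
    (hg : g ∈ G') (hJO : D.J g ⊆ O) : D.strat g u = decB D T V g := by
  rw [mem_cellM] at hu
  obtain ⟨hpat, hform⟩ := hu
  have hf := hform g
  unfold formsOf at hf
  rw [if_pos hg] at hf
  unfold decB
  rw [strat_eq, table_on_cell D g O hJO T u hpat, hf]

/-- a reader's decision AFTER the swap is the index's `decA` on the cell. -/
theorem strat_after (D : JLinData p n) (G' : Finset (Fin (n + 1))) (O : Finset (Fin n)) (s t : Fin n)
    (hst : t.val = s.val + 1) (hsO : s ∈ O) (htO : t ∈ O) (T : Finset (Fin n)) (V : Fin (n + 1) → ZMod p)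
    (u : Fin n → Bool) (hu : u ∈ cellM O (patt T) (formsOf D G') V) (hne : u s ≠ u t) (g : Fin (n + 1)) (hg : g ∈ G')
    (hJO : D.J g ⊆ O) : D.strat g (segCompl u s.val (s.val + 2)) = decA D G' s t T V g := by
  have hM := swap_mem_cellM D G' O s t hst hsO htO T V u hu hne
  unfold decA
  exact strat_before D G' O (swapT T s t) _ _ hM g hg hJO

/-- the index set of the relevant cells: patterns `T ⊆ O` with `u_s ≠ u_t`, form values supported on `G'`, ACTIVE
(all readers other than cut `t` inert, cut `t` accepting before or after). -/
def idxM (D : JLinData p n) (G' : Finset (Fin (n + 1))) (O : Finset (Fin n)) (s t : Fin n) :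
    Finset (Finset (Fin n) × (Fin (n + 1) → ZMod p)) :=
  (O.powerset ×ˢ Fintype.piFinset fun g => if g ∈ G' then (univ : Finset (ZMod p)) else {0}).filter fun TV =>
    patt TV.1 s ≠ patt TV.1 t ∧ (∀ g ∈ G', g ≠ cut t → decA D G' s t TV.1 TV.2 g = decB D TV.1 TV.2 g) ∧
      (decB D TV.1 TV.2 (cut t) = true ∨ decA D G' s t TV.1 TV.2 (cut t) = true)

/-- membership in `idxM`. -/
theorem mem_idxM (D : JLinData p n) (G' : Finset (Fin (n + 1))) (O : Finset (Fin n)) (s t : Fin n)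
    (TV : Finset (Fin n) × (Fin (n + 1) → ZMod p)) :
    TV ∈ idxM D G' O s t ↔ (TV.1 ⊆ O ∧ TV.2 ∈ Fintype.piFinset fun g => if g ∈ G' then (univ : Finset (ZMod p)) else {0}) ∧
      patt TV.1 s ≠ patt TV.1 t ∧ (∀ g ∈ G', g ≠ cut t → decA D G' s t TV.1 TV.2 g = decB D TV.1 TV.2 g) ∧
        (decB D TV.1 TV.2 (cut t) = true ∨ decA D G' s t TV.1 TV.2 (cut t) = true) := by
  unfold idxM
  rw [mem_filter, mem_product, mem_powerset]

/-- the size of the index set: `≤ 2^{|O|}·p^{|G'|}`. -/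
theorem card_idxM_le (D : JLinData p n) (G' : Finset (Fin (n + 1))) (O : Finset (Fin n)) (s t : Fin n) :
    (idxM D G' O s t).card ≤ 2 ^ O.card * p ^ G'.card := by
  classical
  unfold idxM
  refine (card_filter_le _ _).trans ?_
  rw [card_product, card_powerset, Fintype.card_piFinset]
  have h : ∀ g : Fin (n + 1), (if g ∈ G' then (univ : Finset (ZMod p)) else {0}).card = if g ∈ G' then p else 1 := by
    intro g
    split_ifs
    · rw [card_univ, ZMod.card]
    · rw [card_singleton]
  rw [prod_congr rfl fun g _ => h g, prod_ite_mem, univ_inter, prod_const]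

/-- **(rich set ⊆ ⋃ cells).** -/
theorem richLoc_subset (D : JLinData p n) (G' : Finset (Fin (n + 1))) (O : Finset (Fin n)) (s t : Fin n)
    (hst : t.val = s.val + 1) (hsO : s ∈ O) (htO : t ∈ O) (htG : cut t ∈ G') (hJO : ∀ g ∈ G', D.J g ⊆ O) :
    richLoc D.strat s t ⊆ (idxM D G' O s t).biUnion fun TV => cellM O (patt TV.1) (formsOf D G') TV.2 := by
  classical
  intro u hu
  rw [mem_richLoc] at hu
  obtain ⟨hne, hinert, hacc⟩ := hu
  rw [mem_biUnion]
  have hpat := patt_filter O u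
  have hcell : u ∈ cellM O (patt (O.filter fun j => u j = true)) (formsOf D G')
      (fun g => if g ∈ G' then form (D.a g) u else 0) := by
    rw [mem_cellM]
    refine ⟨hpat, fun g => ?_⟩
    unfold formsOf
    by_cases hg : g ∈ G'
    · rw [if_pos hg, if_pos hg]
    · rw [if_neg hg, if_neg hg, form_zero]
  refine ⟨(O.filter fun j => u j = true, fun g => if g ∈ G' then form (D.a g) u else 0), ?_, hcell⟩
  rw [mem_idxM]
  refine ⟨⟨filter_subset _ _, ?_⟩, ?_, ?_, ?_⟩
  · rw [Fintype.mem_piFinset]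
    intro g
    by_cases hg : g ∈ G'
    · simp only [if_pos hg]; exact mem_univ _
    · simp only [if_neg hg]; exact mem_singleton_self _
  · rw [← hpat s hsO, ← hpat t htO]; exact hne
  · intro g hg hgt
    rw [← strat_after D G' O s t hst hsO htO _ _ u hcell hne g hg (hJO g hg),
      ← strat_before D G' O _ _ u hcell g hg (hJO g hg)]
    exact hinert g hgt
  · rcases hacc with h | h
    · left; rw [← strat_before D G' O _ _ u hcell (cut t) htG (hJO _ htG)]; exact h
    · right; rw [← strat_after D G' O s t hst hsO htO _ _ u hcell hne (cut t) htG (hJO _ htG)]; exact h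

/-- the first flipping address class of an active cell. -/
def res1 (F F' : Bool) : ℕ := if F = true ∧ F' = true then 0 else if F = true then 1 else 0

/-- the second flipping address class of an active cell (`b` = the bit `u_s`). -/
def res2 (F F' b : Bool) : ℕ :=
  if F = true ∧ F' = true then (if b = true then 1 else 2) else if F = true then 2 else (if b = true then 2 else 1)

omit hp in
/-- `res1 < 3`. -/
theorem res1_lt (F F' : Bool) : res1 F F' < 3 := by
  unfold res1; split_ifs <;> omega

omit hp in
/-- `res2 < 3`. -/
theorem res2_lt (F F' b : Bool) : res2 F F' b < 3 := by
  unfold res2; split_ifs <;> omega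

omit hp in
/-- the two flipping classes are distinct. -/
theorem res1_ne_res2 (F F' b : Bool) : res1 F F' ≠ res2 F F' b := by
  unfold res1 res2; split_ifs <;> omega

omit hp in
/-- **the flip table** (finite check): on an active cell, an address in one of the two classes makes the fired-and-off-zero
indicator of cut `t` differ before/after the `±1` address shift. -/
theorem flip_key (F F' b : Bool) (r : ℕ) (hr : r < 3) (hacc : F = true ∨ F' = true)
    (h : r = res1 F F' ∨ r = res2 F F' b) :
    (F = true ∧ r ≠ 0) ↔ ¬ (F' = true ∧ (r + if b = true then 2 else 1) % 3 ≠ 0) := by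
  unfold res1 res2 at h
  interval_cases r <;> cases F <;> cases F' <;> cases b <;> simp_all

/-- the flip part of a relevant cell: the two flipping address classes of cut `t`. -/
def flipCellM (c : ℕ) (D : JLinData p n) (G' : Finset (Fin (n + 1))) (O : Finset (Fin n)) (s t : Fin n)
    (TV : Finset (Fin n) × (Fin (n + 1) → ZMod p)) : Finset (Fin n → Bool) :=
  (cellM O (patt TV.1) (formsOf D G') TV.2).filter fun u =>
    addr c u t.val = res1 (decB D TV.1 TV.2 (cut t)) (decA D G' s t TV.1 TV.2 (cut t)) ∨
      addr c u t.val = res2 (decB D TV.1 TV.2 (cut t)) (decA D G' s t TV.1 TV.2 (cut t)) (patt TV.1 s)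

/-- **(flip cells ⊆ flipE)** on a relevant cell, an input whose cut-`t` address lies in one of the two flipping classes
flips the win bit (pair dead outside `G`, `cut t ∈ G' ⊇ G`). -/
theorem flipCellM_subset (c : ℕ) (D : JLinData p n) (s t : Fin n) (hst : t.val = s.val + 1)
    (G G' : Finset (Fin (n + 1))) (hGG : G ⊆ G') (htG : cut t ∈ G')
    (hG : ∀ g, g ∉ G → D.a g s = D.a g t ∧ s ∉ D.J g ∧ t ∉ D.J g)
    (O : Finset (Fin n)) (hsO : s ∈ O) (htO : t ∈ O) (hJO : ∀ g ∈ G', D.J g ⊆ O)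
    (TV : Finset (Fin n) × (Fin (n + 1) → ZMod p)) (hTV : TV ∈ idxM D G' O s t) :
    flipCellM c D G' O s t TV ⊆ flipE c D.strat s t := by
  classical
  intro u hu
  unfold flipCellM at hu
  rw [mem_filter] at hu
  obtain ⟨hcell, haddr⟩ := hu
  have hpat := ((mem_cellM _ _ _ _ u).1 hcell).1
  rw [mem_idxM] at hTV
  obtain ⟨-, hneT, hact, hacc⟩ := hTV
  have hne : u s ≠ u t := by rw [hpat s hsO, hpat t htO]; exact hneT
  have hinert : ∀ g : Fin (n + 1), g ≠ cut t → D.strat g (segCompl u s.val (s.val + 2)) = D.strat g u := by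
    intro g hgt
    by_cases hg : g ∈ G'
    · rw [strat_after D G' O s t hst hsO htO _ _ u hcell hne g hg (hJO g hg),
        strat_before D G' O _ _ u hcell g hg (hJO g hg)]
      exact hact g hg hgt
    · have hd := hG g (fun h => hg (hGG h))
      rw [strat_eq, strat_eq]
      exact cut_swap_insensitive (D.J g) (D.a g) (D.h g) (D.hJ g) u s t hst hne hd.1 hd.2.1 hd.2.2
  rw [mem_flipE]
  refine ⟨hne, ringWinU_swap_of_iff c D.strat u s t hst hne hinert ?_⟩
  have hF := strat_before D G' O _ _ u hcell (cut t) htG (hJO _ htG)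
  have hF' := strat_after D G' O s t hst hsO htO _ _ u hcell hne (cut t) htG (hJO _ htG)
  have hshift := addr_swap_at c u s t hst hne
  rw [← hst] at hshift
  rw [hF, hF', hshift]
  rw [hpat s hsO]
  exact flip_key _ _ _ _ (addr_lt_three c u t.val) hacc haddr

omit hp in
/-- distinct relevant multi-form cells are disjoint. -/
theorem cellM_disjoint (O : Finset (Fin n)) (A : Fin (n + 1) → Fin n → ZMod p) {T T' : Finset (Fin n)} (hT : T ⊆ O)
    (hT' : T' ⊆ O) {V V' : Fin (n + 1) → ZMod p} (hne : (T, V) ≠ (T', V')) :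
    Disjoint (cellM O (patt T) A V) (cellM O (patt T') A V') := by
  rw [disjoint_left]
  intro u hu hu'
  rw [mem_cellM] at hu hu'
  apply hne
  have hTT : T = T' := by
    ext j
    by_cases hj : j ∈ O
    · have h1 := hu.1 j hj
      have h2 := hu'.1 j hj
      unfold patt at h1 h2
      rw [h1] at h2
      simpa using h2
    · exact ⟨fun h => absurd (hT h) hj, fun h => absurd (hT' h) hj⟩
  have hVV : V = V' := funext fun g => by rw [← hu.2 g, ← hu'.2 g]
  rw [hTT, hVV]

end LocEngine

end Summit.QuantumAdvantage.AdviceFreeQNC0.JLinPeel.TokenDial
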